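import Literature.MathematicalPhysics.QuantumFieldTheory.Balaban1983to89.B7Prop3GeneralLinearBoundRec
import Literature.MathematicalPhysics.QuantumFieldTheory.Balaban1983to89.B7Prop3GaugeCarryRec

/-!
# `Balaban1983to89.B7Prop3GeneralLinearPdevRec` — [Balaban1985Averaging] PROPOSITION 3 AT A GENERAL BACKGROUND FOR THE RECORD's AVERAGING STRUCTURE ([Balaban1987RG1] (0.4)):
# (126) FOR THE GAUGE-CORRECTED LINEAR PART `Q̂(V₀)A` FROM THE PLAQUETTE DEVIATION OF THE BACKGROUND, and the record's `h3lin`-with-source (road (A′), item N2c)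

statement-level skeleton of published theorems with citation tags; proofs where landed; nothing here is a claim about the Yang–Mills mass gap

CITATION HEADER (lean-in-tree rule).  Cell `pub-ymgap`, seat `pub-ymgap-dag-n05-e` g36 (N05-REC LEAD PEN); item R1 ([3] layer), the N2c file of director-ym №265 (2) ∕ plan SIZING
I.45677 («`h3lin` for Q̂ — print's (128) proof verbatim + D₀»).  Record twin of the engine's `B7Prop3GeneralLinearPdev` (`norm_linQcov_le_of_pdev`, `h3lin_discharge`).
`--kind proof --supports stmt-QuantumFields-20541` (K0⁷; count-neutral; no definition).  Sources READ: [3] = [Balaban1985Averaging] pp. 24 (44), 36 (124)–(126), 38 (128), (131)–(133)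
(`paper:balaban1985-cmp98-averaging`); [I] = [Balaban1987RG1] (0.3)–(0.4) pp. 252–253.  REUSED BY NAME: `B7Prop3GeneralLinearBoundRec.norm_linQcovZ_gaugeCorrected_le` (N2a: the three
brackets + `D₀` under the loop-regularity letters `ε`, `ε′`), dag-n05-d's `B8Lemma1NonAbelianRecLoops.norm_WZ_sub_one_le` (`ε = ω(d, L)·α₀` for the (0.4) loops) and `norm_hol_sub_one_le_walkSum`,
`B7Prop3StaircaseStokesCovRec.walkSum_le_of_linear` + the engine's `axialFn ∕ axial_bond_bound ∕ hol_axial_treeWord` (`ε′ = (d·s)²·α₀` for the two-staircase loops of `D₀`),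
`B7Prop3GaugeCarryRec.QhatZ ∕ norm_dcovZ_lamZ_le`, `B7Prop2Explicit.pdev ∕ le_pdev`.

WHAT IS PROVED (sorry-free).  §1 the loop-regularity letters from the plaquette bound (44) `|V₀(∂p) − 1| ≤ α₀`, `V₀ ∈ U1`, `L = 2s + 1`: `WZ_regular_of_plaquettes`
(`‖W_i(V₀) − 1‖ ≤ ω(d,L)·α₀`, `ω = (d−1)s(ds + L)`, dag-n05-d's constant), ★`stairLoop_regular_of_plaquettes` (`‖V₀((−Γ_{q,x}) ∪ Γ^σ_{q,x}) − 1‖ ≤ (d·s)²·α₀`: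
axial gauge at `q`, the tree leg is `1`, the σ-leg costs `walkSum ≤ |n|₁²α₀`); §2 ★★`norm_QhatZ_le_of_plaquettes` — (126) FOR `Q̂`: `‖Q̂(V₀)A‖ ≤ L·(1 + c_rec·L²α₀)·|A|`,
`c_rec = 16(d+1)(d+2)²` (from `(1 + 50(d+1)ε + 2ε′)` with `ε ≤ d(d+2)L²α₀∕4`, `ε′ ≤ d²L²α₀∕4`), under `2d(d+2)L²α₀ ≤ 1` (makes `ε ≤ 1∕8`); `norm_QhatZ_le_of_pdev` (the same from
`pdev V₀ ≤ β`); §3 ★★`norm_linQcovZ_le_of_pdev_of_curl` — THE RECORD's `h3lin` WITH SOURCE: `‖L(Q(V₀)A)_c‖ ≤ L·(1 + c_rec·L²β)·|A| + 2·[(d·s)²·P + 36(d·s)²(d·s+4)·β·|A|]`, `P` a bound of the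
covariant plaquette curls of `A` — the shape the record's Prop. 4 induction consumes (engine binder `h3lin` plus an additive curvature source; SOCKET-CHECK-N2.md ∕ director-ym №266).
HONEST SCOPE.  Estimates for OUR typed record objects with explicit, unoptimised constants; the located point stands: (126)∕(128) hold for `Q̂`, NOT for `linQcovZ` (the source `2(d·s)²·P` has no
small factor in `sup|A|`); nothing of [3]∕[6]∕[I] asserted; `HThm4Rec` UNDISCHARGED; N05 discharged of record untouched; N07 not claimable; counts unmoved (typed 28∕28 · discharged 8∕28); one
finite 𝕋⁴ programme at fixed ε — nothing continuum ∕ ℝ⁴ ∕ OS ∕ mass gap ∕ Clay.  No `def`, no `instance`, no `notation`, no `sorry`.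
-/

set_option autoImplicit false

noncomputable section

open scoped BigOperators
open Finset

namespace Literature.MathematicalPhysics.QuantumFieldTheory.Balaban1983to89.B7Prop3GeneralLinearPdevRec

open B7Prop1Explicit hiding Site
open B7Prop1Explicit renaming Site → SiteZ
open B7Prop2Explicit (pdev le_pdev pdev_nonneg)
open B7Prop3GeneralRotated
open B7Eq78Linearization (conjR conjR_apply)
open B8Lemma1NonAbelianRecLoops (walkSum norm_hol_sub_one_le_walkSum norm_WZ_sub_one_le omegaC pairLo pairHi)
open BlockAveragingZd (offZ IdxZ WZ bavgZ l1_offZ_le length_stairWord)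
open B7SectEFLinearisationRec (linQcovZ)
open B7Prop3GeneralLinearBoundRec (norm_linQcovZ_gaugeCorrected_le)
open B7Prop3StaircaseStokesCovRec (walkSum_le_of_linear)
open B7Prop3GaugeCarryRec (lamZ dcovZ QhatZ QhatZ_def dcovZ_apply lamZ_def linQcovZ_eq_QhatZ_add_dcovZ norm_dcovZ_lamZ_le)
open T4Continuum (stairWord)

variable {d : ℕ}

variable {𝔸 : Type*} [NormedRing 𝔸] [NormedAlgebra ℂ 𝔸] [NormOneClass 𝔸] [CompleteSpace 𝔸]
variable (L : ℕ)

/-! ## §1 The loop-regularity letters `ε`, `ε′` from the plaquette bound (44) -/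

section Loops

variable {V₀ : SiteZ d → Fin d → 𝔸ˣ} (hV₀ : ∀ x κ, V₀ x κ ∈ U1 𝔸) {α : ℝ} (hα : 0 ≤ α)
  (h44 : ∀ (x : SiteZ d) (κ μ : Fin d), κ ≠ μ → ‖((hol V₀ x (plaqWord κ μ) : 𝔸ˣ) : 𝔸) - 1‖ ≤ α)
include hV₀ hα h44

omit [NormedAlgebra ℂ 𝔸] [CompleteSpace 𝔸] in
/-- **`ε` — the (0.4) loops are regular**: `‖V₀(Γ^σ ∪ [x,x′] ∪ (−Γ^{σ′}) ∪ (−c)) − 1‖ ≤ ω(d, L)·α₀`, `ω = (d−1)·s·(d·s + L)` (dag-n05-d's sharp tree-gauge count `norm_WZ_sub_one_le`, here fed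
with the GLOBAL plaquette bound (44)). [cite: Balaban1985Averaging, (44) p.24, (47) p.25; Balaban1987RG1, (0.4) p.253; Balaban1985RegularSpaces, Lemma 1 p.79] -/
theorem WZ_regular_of_plaquettes {s : ℕ} (hL : L = 2 * s + 1) (q : SiteZ d) (κ : Fin d) (i : IdxZ d L) :
    ‖((WZ L V₀ q κ i : 𝔸ˣ) : 𝔸) - 1‖ ≤ omegaC d L α := by
  have hP : B8Lemma1NonAbelian.PlaqSmall V₀ (pairLo L q) (pairHi L q κ) α := fun x κ' μ hne _ _ => h44 x κ' μ hne
  exact norm_WZ_sub_one_le hL V₀ hV₀ hP hα q κ le_rfl le_rfl i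

omit [NormedAlgebra ℂ 𝔸] [CompleteSpace 𝔸] in
/-- ★ **`ε′` — the two-staircase loops of the rotation defect `D₀` are regular**: `‖V₀((−Γ_{q,x}) ∪ Γ^σ_{q,x}) − 1‖ ≤ (d·s)²·α₀` for `x = q + offZ L r`, `L = 2s + 1`.  In the engine's
block axial gauge rooted at `q` the tree leg is `1` (`hol_axial_treeWord`) and the σ-staircase from `q` costs at most its `walkSum ≤ |n|₁²·α₀` (bond bound `|V₀^{ax}(b) − 1| ≤ |b₋ − q|₁α₀`);
the closed loop is then conjugated back by (8). [cite: Balaban1985Averaging, (44) p.24, (8) p.18, (82) p.30; Balaban1987RG1, (0.3) p.252] -/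
theorem stairLoop_regular_of_plaquettes {s : ℕ} (hL : L = 2 * s + 1) (q : SiteZ d) (r : Fin d → Fin L) (σ : Equiv.Perm (Fin d)) :
    ‖((hol V₀ (q + offZ L r) (revWord (treeWord (offZ L r)) ++ stairWord σ (offZ L r)) : 𝔸ˣ) : 𝔸) - 1‖ ≤ ((d : ℝ) * s) ^ 2 * α := by
  set n := offZ L r with hn
  set g : SiteZ d → 𝔸ˣ := axialFn V₀ q with hg
  set V' : SiteZ d → Fin d → 𝔸ˣ := gaugeAct g V₀ with hV'
  have hg1 : ∀ z, g z ∈ U1 𝔸 := fun z => axialFn_mem hV₀ q z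
  have hV'1 : ∀ x κ, V' x κ ∈ U1 𝔸 := fun x κ => gaugeAct_mem hV₀ hg1 x κ
  have hlin : ∀ z μ, ‖((V' z μ : 𝔸ˣ) : 𝔸) - 1‖ ≤ l1 (z - q) * α := fun z μ => axial_bond_bound V₀ hV₀ q h44 hα z μ
  have hclosed : disp (revWord (treeWord n) ++ stairWord σ n) = 0 := by
    rw [disp_append, disp_revWord, disp_treeWord, BlockAveragingZd.disp_stairWord]; abel
  -- in the axial gauge the loop is the σ-staircase alone
  have hloop' : hol V' (q + n) (revWord (treeWord n) ++ stairWord σ n) = hol V' q (stairWord σ n) := by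
    rw [hol_append, disp_revWord, disp_treeWord, add_neg_cancel_right,
      hol_revWord' V' (q + n) (treeWord n) (by rw [disp_treeWord]), hV', hg, hol_axial_treeWord, inv_one, one_mul]
  -- back to V₀ by (8) on the closed loop
  have hconjU : hol V₀ (q + n) (revWord (treeWord n) ++ stairWord σ n) = (g (q + n))⁻¹ * hol V' q (stairWord σ n) * g (q + n) := by
    rw [← hloop', hV', hol_gaugeAct_closed g V₀ (q + n) _ hclosed]
    group
  rw [hconjU, Units.val_mul, Units.val_mul]
  refine (norm_units_inv_conj_sub_one_le (hg1 _) _).trans ?_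
  refine (norm_hol_sub_one_le_walkSum hV'1 q (stairWord σ n)).trans ?_
  have hw := walkSum_le_of_linear hV'1 q hα hlin (stairWord σ n) q
  rw [sub_self, length_stairWord] at hw
  have h0 : l1 (0 : SiteZ d) = 0 := by simp [l1]
  rw [h0, Nat.cast_zero, zero_add] at hw
  have hnl : (l1 n : ℝ) ≤ d * s := by exact_mod_cast l1_offZ_le hL r
  have hl0 : (0 : ℝ) ≤ l1 n := by positivity
  calc walkSum V' q (stairWord σ n) ≤ l1 n * (l1 n * α) := hw
    _ ≤ ((d : ℝ) * s) * (((d : ℝ) * s) * α) := by gcongr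
    _ = ((d : ℝ) * s) ^ 2 * α := by ring

end Loops

/-! ## §2 (126) for the gauge-corrected linear part `Q̂(V₀)A` from the plaquette bound -/

section Qhat

variable {V₀ : SiteZ d → Fin d → 𝔸ˣ} (hV₀ : ∀ x κ, V₀ x κ ∈ U1 𝔸) {α : ℝ} (hα : 0 ≤ α)
  (h44 : ∀ (x : SiteZ d) (κ μ : Fin d), κ ≠ μ → ‖((hol V₀ x (plaqWord κ μ) : 𝔸ˣ) : 𝔸) - 1‖ ≤ α)
  {A : SiteZ d → Fin d → 𝔸} {a : ℝ} (ha : 0 ≤ a) (hA : ∀ x κ, ‖A x κ‖ ≤ a)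
include hV₀ hα h44 ha hA

omit hV₀ h44 ha hA in
/-- Bookkeeping for the constants: with `L = 2s + 1 ≥ 1`, `ω(d, L) ≤ d(d+2)L²∕4` and `(d·s)² ≤ d²L²∕4`. [cite: Balaban1985Averaging, (126) p.36 (bookkeeping)] -/
theorem omegaC_le {s : ℕ} (hL : L = 2 * s + 1) : omegaC d L α ≤ (d : ℝ) * (d + 2) * (L : ℝ) ^ 2 / 4 * α ∧ ((d : ℝ) * s) ^ 2 * α ≤ (d : ℝ) ^ 2 * (L : ℝ) ^ 2 / 4 * α := by
  have hLr : (L : ℝ) = 2 * s + 1 := by exact_mod_cast hL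
  have hs : ((L : ℝ) - 1) / 2 = s := by rw [hLr]; ring
  have hsL : (s : ℝ) ≤ (L : ℝ) / 2 := by rw [hLr]; linarith
  have hs0 : (0 : ℝ) ≤ s := by positivity
  have hd0 : (0 : ℝ) ≤ d := by positivity
  have hL0 : (0 : ℝ) ≤ L := by positivity
  constructor
  · unfold omegaC
    rw [hs]
    have h3 : 0 ≤ (d : ℝ) * s + L := by positivity
    have p1 : 0 ≤ (s : ℝ) * ((d : ℝ) * s + L) * α := by positivity
    have h2 : (d : ℝ) * s + L ≤ (d + 2) * ((L : ℝ) / 2) := by nlinarith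
    calc ((d : ℝ) - 1) * s * ((d : ℝ) * s + L) * α ≤ (d : ℝ) * s * ((d : ℝ) * s + L) * α := by nlinarith
      _ ≤ (d : ℝ) * ((L : ℝ) / 2) * ((d + 2) * ((L : ℝ) / 2)) * α := by gcongr
      _ = (d : ℝ) * (d + 2) * (L : ℝ) ^ 2 / 4 * α := by ring
  · calc ((d : ℝ) * s) ^ 2 * α ≤ ((d : ℝ) * ((L : ℝ) / 2)) ^ 2 * α := by gcongr
      _ = (d : ℝ) ^ 2 * (L : ℝ) ^ 2 / 4 * α := by ring

/-- ★★ **(126) FOR THE GAUGE-CORRECTED LINEAR PART OF THE RECORD**: at a background `V₀ ∈ U1` with `|V₀(∂p) − 1| ≤ α₀` (44) and `2d(d+2)L²α₀ ≤ 1`, for `|A| ≤ a`, at every `L`-bond: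
`‖Q̂(V₀)A‖ ≤ L·(1 + 16(d+1)(d+2)²·L²α₀)·a` — print's «|(Q(V₀)A)_c| ≦ (1 + O(1)L²α₀)|A|» with leading coefficient EXACTLY `L`, for `Q̂` (N2a's `norm_linQcovZ_gaugeCorrected_le` with
`ε = ω(d,L)α₀ ≤ d(d+2)L²α₀∕4 ≤ 1∕8`, `ε′ = (d·s)²α₀ ≤ d²L²α₀∕4`). [cite: Balaban1985Averaging, (126) p.36, (44) p.24; Balaban1987RG1, (0.4) p.253] -/
theorem norm_QhatZ_le_of_plaquettes {s : ℕ} (hL : L = 2 * s + 1) (hsmall : 2 * (d : ℝ) * (d + 2) * (L : ℝ) ^ 2 * α ≤ 1) (q : SiteZ d) (κ : Fin d) :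
    ‖QhatZ L V₀ A q κ‖ ≤ L * (1 + 16 * ((d : ℝ) + 1) * ((d : ℝ) + 2) ^ 2 * (L : ℝ) ^ 2 * α) * a := by
  have hL1 : 1 ≤ L := by omega
  obtain ⟨hω, hε'⟩ := omegaC_le L hα hL
  have hd0 : (0 : ℝ) ≤ d := by positivity
  have hL0 : (0 : ℝ) ≤ L := by positivity
  have hε0 : 0 ≤ max (omegaC d L α) 0 := le_max_right _ _
  have hquarter : (d : ℝ) * (d + 2) * (L : ℝ) ^ 2 / 4 * α ≤ 1 / 8 := by nlinarith
  have hε : max (omegaC d L α) 0 ≤ 1 / 8 := max_le (hω.trans hquarter) (by norm_num)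
  have hεq : max (omegaC d L α) 0 ≤ (d : ℝ) * (d + 2) * (L : ℝ) ^ 2 / 4 * α := max_le hω (by positivity)
  have hW : ∀ i : IdxZ d L, ‖((WZ L V₀ q κ i : 𝔸ˣ) : 𝔸) - 1‖ ≤ max (omegaC d L α) 0 :=
    fun i => (WZ_regular_of_plaquettes L hV₀ hα h44 hL q κ i).trans (le_max_left _ _)
  have hloop : ∀ (r : Fin d → Fin L) (σ : Equiv.Perm (Fin d)),
      ‖((hol V₀ (q + offZ L r) (revWord (treeWord (offZ L r)) ++ stairWord σ (offZ L r)) : 𝔸ˣ) : 𝔸) - 1‖ ≤ ((d : ℝ) * s) ^ 2 * α :=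
    fun r σ => stairLoop_regular_of_plaquettes L hV₀ hα h44 hL q r σ
  have hmain := norm_linQcovZ_gaugeCorrected_le L hV₀ ha hA hL1 q κ hε0 hε hW hloop
  have hQ : QhatZ L V₀ A q κ = linQcovZ L V₀ A q κ
      - ((∑ i : IdxZ d L, ((Fintype.card (IdxZ d L) : ℝ))⁻¹ • tsum V₀ A q (stairWord i.2.1 (offZ L i.1)) - B7SectEFLinearisationRec.FhatCovZ L V₀ A q)
          - conjR (bavgZ L V₀ q κ)
              (∑ i : IdxZ d L, ((Fintype.card (IdxZ d L) : ℝ))⁻¹ • tsum V₀ A (q + (L : ℤ) • e κ) (stairWord i.2.1 (offZ L i.1))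
                - B7SectEFLinearisationRec.FhatCovZ L V₀ A (q + (L : ℤ) • e κ))) := by
    rw [QhatZ_def, dcovZ_apply, lamZ_def, lamZ_def]
  rw [hQ]
  refine hmain.trans ?_
  have hLa : 0 ≤ (L : ℝ) * a := by positivity
  have hL2α : 0 ≤ (L : ℝ) ^ 2 * α * ((L : ℝ) * a) := by positivity
  have key : 50 * ((d : ℝ) + 1) * ((d : ℝ) * (d + 2) / 4) + 2 * ((d : ℝ) ^ 2 / 4) ≤ 16 * ((d : ℝ) + 1) * ((d : ℝ) + 2) ^ 2 := by
    nlinarith [hd0, sq_nonneg (d : ℝ), mul_nonneg hd0 hd0, mul_nonneg (mul_nonneg hd0 hd0) hd0]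
  calc (1 + 50 * (d + 1) * max (omegaC d L α) 0 + 2 * (((d : ℝ) * s) ^ 2 * α)) * (L * a)
      ≤ (1 + 50 * (d + 1) * ((d : ℝ) * (d + 2) * (L : ℝ) ^ 2 / 4 * α) + 2 * ((d : ℝ) ^ 2 * (L : ℝ) ^ 2 / 4 * α)) * (L * a) := by
        gcongr
    _ = (L : ℝ) * a + (50 * ((d : ℝ) + 1) * ((d : ℝ) * (d + 2) / 4) + 2 * ((d : ℝ) ^ 2 / 4)) * ((L : ℝ) ^ 2 * α * ((L : ℝ) * a)) := by ring
    _ ≤ (L : ℝ) * a + 16 * ((d : ℝ) + 1) * ((d : ℝ) + 2) ^ 2 * ((L : ℝ) ^ 2 * α * ((L : ℝ) * a)) := by gcongr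
    _ = L * (1 + 16 * ((d : ℝ) + 1) * ((d : ℝ) + 2) ^ 2 * (L : ℝ) ^ 2 * α) * a := by ring

end Qhat

/-! ## §3 From the plaquette deviation `pdev`; the record's `h3lin` with the curvature source -/

section Source

variable {V₀ : SiteZ d → Fin d → 𝔸ˣ} (hV₀ : ∀ x κ, V₀ x κ ∈ U1 𝔸)
  {A : SiteZ d → Fin d → 𝔸} {a : ℝ} (ha : 0 ≤ a) (hA : ∀ x κ, ‖A x κ‖ ≤ a)
include hV₀ ha hA

/-- The same from the plaquette deviation `pdev V₀ ≤ β` of the lineage (`B7Prop2Explicit.pdev`, the sup over all plaquettes). [cite: Balaban1985Averaging, (126) p.36, (44) p.24, (52) p.26] -/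
theorem norm_QhatZ_le_of_pdev {s : ℕ} (hL : L = 2 * s + 1) {β : ℝ} (hβ : pdev V₀ ≤ β)
    (hsmall : 2 * (d : ℝ) * (d + 2) * (L : ℝ) ^ 2 * β ≤ 1) (q : SiteZ d) (κ : Fin d) :
    ‖QhatZ L V₀ A q κ‖ ≤ L * (1 + 16 * ((d : ℝ) + 1) * ((d : ℝ) + 2) ^ 2 * (L : ℝ) ^ 2 * β) * a := by
  have hβ0 : 0 ≤ β := (pdev_nonneg V₀).trans hβ
  exact norm_QhatZ_le_of_plaquettes L hV₀ hβ0 (fun x κ' μ _ => (le_pdev hV₀ x κ' μ).trans hβ) ha hA hL hsmall q κ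

/-- ★★ **THE RECORD's LINEAR BOUND WITH SOURCE** (what replaces the engine binder `h3lin` on the road): at a background `V₀ ∈ U1` with `pdev V₀ ≤ β`, `2d(d+2)L²β ≤ 1`, averaged bond
`V̄₀(c) ∈ U1`, for `|A| ≤ a` and `P` a bound of the covariant plaquette curls `‖(R_{0,x}A)(∂p)‖`:
`‖L(Q(V₀)A)_c‖ ≤ L·(1 + 16(d+1)(d+2)²L²β)·a + 2·[(d·s)²·P + 36(d·s)²(d·s+4)·β·a]` — (126)∕(128) for `Q̂` plus the carried gauge term of one bond bounded by the N2 estimate.  The first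
summand is print's shape (coefficient EXACTLY `L`, the `O(β)` loss multiplying up to `e^{O(α₀)}` over the levels); the source is small in the CURVATURE of `A`, read on the road from the
plaquette hypotheses of `HThm4Rec` (SOCKET-CHECK-N2.md, director-ym №266). [cite: Balaban1985Averaging, (126) p.36, (128) p.38, (131)–(133) p.38; Balaban1987RG1, (0.4) p.253] -/
theorem norm_linQcovZ_le_of_pdev_of_curl {s : ℕ} (hL : L = 2 * s + 1) {β : ℝ} (hβ : pdev V₀ ≤ β)
    (hsmall : 2 * (d : ℝ) * (d + 2) * (L : ℝ) ^ 2 * β ≤ 1)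
    {P : ℝ} (hP0 : 0 ≤ P) (hP : ∀ (x : SiteZ d) (μ ν : Fin d), μ ≠ ν → ‖tsum V₀ A x (plaqWord μ ν)‖ ≤ P)
    (q : SiteZ d) (κ : Fin d) (hb : bavgZ L V₀ q κ ∈ U1 𝔸) :
    ‖linQcovZ L V₀ A q κ‖ ≤ L * (1 + 16 * ((d : ℝ) + 1) * ((d : ℝ) + 2) ^ 2 * (L : ℝ) ^ 2 * β) * a
      + 2 * (((d : ℝ) * s) ^ 2 * P + 36 * ((d : ℝ) * s) ^ 2 * ((d : ℝ) * s + 4) * β * a) := by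
  have hβ0 : 0 ≤ β := (pdev_nonneg V₀).trans hβ
  have h44 : ∀ (x : SiteZ d) (κ' μ : Fin d), κ' ≠ μ → ‖((hol V₀ x (plaqWord κ' μ) : 𝔸ˣ) : 𝔸) - 1‖ ≤ β :=
    fun x κ' μ _ => (le_pdev hV₀ x κ' μ).trans hβ
  rw [linQcovZ_eq_QhatZ_add_dcovZ]
  exact (norm_add_le _ _).trans (add_le_add (norm_QhatZ_le_of_pdev L hV₀ ha hA hL hβ hsmall q κ)
    (norm_dcovZ_lamZ_le L hL hV₀ hβ0 h44 ha hA hP0 hP q κ hb))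

end Source

end Literature.MathematicalPhysics.QuantumFieldTheory.Balaban1983to89.B7Prop3GeneralLinearPdevRec
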